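import Mathlib
import Literature.MathematicalPhysics.QuantumFieldTheory.Balaban1983to89.T4EtaRateCoeffDefect
import Literature.MathematicalPhysics.QuantumFieldTheory.Balaban1983to89.T4EtaRateDefectSite
import HarnessLib

/-!
# Route «BalabanUVNodes» (K4 «SpineRates»), node N15 = NE2, BACKGROUND LAYER — THE INTERFACE OF THE `U ≡ 1` INPUT: for KERNEL operators under the
# piecewise-constant pull-back the η-defect is the kernel operator `K′P − PK` — the BLOCK-SUMMED fine kernel minus the coarse kernel — and its
# block majorant (binder (a) of the background step) IS a pointwise inequality on that kernel

Cell `pub-ymgap`, seat `pub-ymgap-dag-n15-b` (FIRST-MISSING-ESTIMATE, D-0062; `bears_on: R4∕N15`; `--supports stmt-QuantumFields-19351 --as helper`).  Imports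
`T4EtaRateCoeffDefect` (`pull`) and `T4EtaRateDefectSite` (`entry`, `entry_le_of_hasMaj_wnorm`, `isLoc_ofBlocks_single`, `loc_ofBlocks_single`) of the
η-rate lineage (cell `pub-balaban`, pv25) BY NAME; nothing landed is modified.

THE POINT.  This seat's background step (`…N15.BackgroundStep.idef_background_propagator_majorant`, p409422) reduces the η-defect of the background
propagator to letters and to ONE input of the node's `U ≡ 1` layer (the -a seat's): binder (a), a source-weighted block majorant of `𝔇(G₁′, G₁) = G₁′∘τ − τ∘G₁`
for the two runs' `U ≡ 1` (local) propagators under the pairing `τ = pull π` (King, CMP 102 (1986) p. 664: *«When x′ ∈ T_{η′}, we denote by x that point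
in T_η for which x′ ∈ B^n(x)»*; convention (C2) of `pub-balaban/t4/T4-EST-U1a.md`).  The `U ≡ 1` propagators are KERNEL operators (`(G₁f)(x) = Σ_u K(x,u)f(u)`;
on the unit torus the tree's torus kernels of `T4EtaRateSiteTorus` ∕ the -a knit `NE2NodeTorus`, read in momentum space by King's (4.1)–(4.4) p. 670 —
`King1986.EffectiveLaplacianRate`).  THIS FILE states binder (a) in THEIR currency:
* §1 the pull-back is the kernel operator of the 0∕1 matrix `P = pullMatrix π` (`P(x′,u) = 1_{πx′ = u}`);
* §2 EXACT: `𝔇(K′, K) := idef (pull π) (pull π) (mulVecLin K′) (mulVecLin K) = mulVecLin (K′P − PK)` (`idef_kernel_eq`), with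
  `(K′P)(x′,u) = Σ_{u′ ∈ π⁻¹(u)} K′(x′,u′)` — the fine kernel SUMMED OVER THE SOURCE BLOCK — and `(PK)(x′,u) = K(πx′,u)` — the coarse kernel at the
  block of the observation point (`blockSum_apply`, `pullMatrix_mul_apply`);
* §3 THE DICTIONARY (coarse lattice = the sites 𝔅 themselves, fine cubes `blk′`; both norms reweighted, `T4EtaRateDefect.wnorm`):
  `HasMaj (wnorm (ofBlocks id) w₁) (wnorm (ofBlocks blk′) w₂) T N ↔ ∀ x′ u, w₂(blk′x′)·|entry T x′ u| ≤ N(blk′x′, u)·w₁(u)` (`hasMaj_site_cube_iff`; the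
  tree's `hasMaj_wnorm_site_iff` is the case of single sites on both sides);
* §4 THE READING: binder (a) for kernel operators — `HasMaj (wnorm (ofBlocks id) w) (wnorm (ofBlocks π) W) 𝔇(K′,K) N` — IS the pointwise inequality
  `W(πx′)·|Σ_{u′∈B(u)} K′(x′,u′) − K(πx′,u)| ≤ N(πx′,u)·w(u)` (`binderA_iff_kernel_bound`): the momentum-space side has to bound the BLOCK-SUMMED fine
  kernel against the coarse kernel, uniformly in the position of `x′` inside its block, with the observation weight `W` (the (3.42) prefactor,
  `…N15.OperatorReadout.prefWeight`) and the source weight `w` (the η-rate weight `T4EtaRateDefect.rateWeight`).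

HONEST FRAMING ∕ LIMITS.  [folklore] matrix algebra and one dictionary; nothing about any propagator is asserted; no momentum-space estimate is made (that is
the `U ≡ 1` layer's content: King's Lemma 4.3∕4.4 mechanism, the -a seat's torus rates).  NE2⁺ NOT PRINTED, NOT proved; count-neutral (typed 28∕28 ·
discharged 0∕28); one finite T⁴ at fixed ε — NOT infinite volume, NOT OS on ℝ⁴, NOT a mass gap, NOT Clay.
-/

noncomputable section

namespace Summit.QuantumFields.YangMills.BalabanUVNodes.N15.KernelDefect

open Literature.MathematicalPhysics.QuantumFieldTheory.Balaban1983to89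
open Literature.MathematicalPhysics.QuantumFieldTheory.Balaban1983to89.B11SectG (BlockNorm HasMaj)
open Literature.MathematicalPhysics.QuantumFieldTheory.Balaban1983to89.T4EtaRateDefect (idef wnorm)
open Literature.MathematicalPhysics.QuantumFieldTheory.Balaban1983to89.T4EtaRateCoeffDefect (pull pull_apply)
open Literature.MathematicalPhysics.QuantumFieldTheory.Balaban1983to89.T4EtaRateDefectSite (entry entry_apply entry_le_of_hasMaj_wnorm
  isLoc_ofBlocks_single loc_ofBlocks_single)
open Literature.MathematicalPhysics.QuantumFieldTheory.Balaban1983to89.B11AxialTransport190 (abs_le_loc_ofBlocks loc_ofBlocks_le)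

/-! ## §1 The pull-back as a kernel operator -/

section Pull

variable {X X' : Type} [DecidableEq X] (π : X' → X)

/-- THE PULL-BACK MATRIX `P(x′,u) = 1_{πx′ = u}` of the block projection `π`. [folklore] -/
def pullMatrix : Matrix X' X ℝ := Matrix.of fun x' u => if π x' = u then 1 else 0

/-- Entries of the pull-back matrix. [folklore] -/
@[simp] theorem pullMatrix_apply (x' : X') (u : X) : pullMatrix π x' u = if π x' = u then 1 else 0 := rfl

variable [Fintype X]

/-- The pull-back IS the kernel operator of `P`: `(Pf)(x′) = f(πx′)`. [folklore] -/
theorem mulVecLin_pullMatrix : Matrix.mulVecLin (pullMatrix π) = pull π := by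
  ext f x'
  simp [Matrix.mulVec, dotProduct, pullMatrix, Finset.sum_ite_eq, pull_apply]

end Pull

/-! ## §2 The exact defect of two kernel operators: block-summed fine kernel minus coarse kernel -/

section Exact

variable {X X' : Type} [DecidableEq X] (π : X' → X)

/-- `(K′P)(x′,u) = Σ_{u′ : πu′ = u} K′(x′,u′)`: the fine kernel SUMMED OVER THE SOURCE BLOCK `π⁻¹(u)`. [folklore] -/
theorem blockSum_apply [Fintype X'] (K' : Matrix X' X' ℝ) (x' : X') (u : X) :
    (K' * pullMatrix π) x' u = ∑ u' : X', if π u' = u then K' x' u' else 0 := by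
  simp only [Matrix.mul_apply, pullMatrix_apply, mul_ite, mul_one, mul_zero]

/-- `(PK)(x′,u) = K(πx′,u)`: the coarse kernel at the block of the observation point. [folklore] -/
theorem pullMatrix_mul_apply [Fintype X] (K : Matrix X X ℝ) (x' : X') (u : X) : (pullMatrix π * K) x' u = K (π x') u := by
  simp only [Matrix.mul_apply, pullMatrix_apply, ite_mul, one_mul, zero_mul, Finset.sum_ite_eq, Finset.mem_univ, if_true]

/-- **THE EXACT DEFECT OF TWO KERNEL OPERATORS under the pull-back pairing**: `𝔇(K′, K) = K′∘P − P∘K` is the kernel operator of the matrix `K′P − PK`,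
i.e. of `(x′,u) ↦ Σ_{u′∈π⁻¹(u)} K′(x′,u′) − K(πx′,u)`. [folklore] -/
theorem idef_kernel_eq [Fintype X] [Fintype X'] (K' : Matrix X' X' ℝ) (K : Matrix X X ℝ) :
    idef (pull π) (pull π) (Matrix.mulVecLin K') (Matrix.mulVecLin K) = Matrix.mulVecLin (K' * pullMatrix π - pullMatrix π * K) := by
  rw [← mulVecLin_pullMatrix π]
  ext f x'
  simp only [T4EtaRateDefect.idef_apply, LinearMap.comp_apply, Matrix.mulVecLin_apply, Pi.sub_apply, Matrix.sub_mulVec,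
    Matrix.mulVec_mulVec]

/-- Its matrix entries: `entry 𝔇(K′,K) x′ u = Σ_{u′∈π⁻¹(u)} K′(x′,u′) − K(πx′,u)`. [folklore] -/
theorem entry_idef_kernel [Fintype X] [Fintype X'] (K' : Matrix X' X' ℝ) (K : Matrix X X ℝ) (x' : X') (u : X) :
    entry (idef (pull π) (pull π) (Matrix.mulVecLin K') (Matrix.mulVecLin K)) x' u =
      (∑ u' : X', if π u' = u then K' x' u' else 0) - K (π x') u := by
  rw [idef_kernel_eq, entry_apply, Matrix.mulVecLin_apply, ← blockSum_apply π K' x' u, ← pullMatrix_mul_apply π K x' u,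
    ← Matrix.sub_apply]
  simp only [Matrix.mulVec, dotProduct, Pi.single_apply, mul_ite, mul_one, mul_zero, Finset.sum_ite_eq', Finset.mem_univ,
    if_true]

end Exact

/-! ## §3 The dictionary: coarse single sites, fine cubes, both norms reweighted -/

section Dictionary

variable {g : B6.Geometry} [DecidableEq g.Site] {X' : Type} [Fintype X'] (blk' : X' → g.Site)

/-- **THE DICTIONARY** for an operator from functions on 𝔅 (single-site cubes) to fine-lattice functions (cubes `blk′`), between REWEIGHTED sharp cube
norms: `HasMaj (wnorm (ofBlocks id) w₁) (wnorm (ofBlocks blk′) w₂) T N` IS the pointwise bound `w₂(blk′x′)·|entry T x′ u| ≤ N(blk′x′, u)·w₁(u)`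
(the tree's `T4EtaRateDefectSite.hasMaj_wnorm_site_iff` is the case `blk′ = id`). [folklore] -/
theorem hasMaj_site_cube_iff {w₁ w₂ : g.Site → ℝ} (hw₁ : ∀ y, 0 ≤ w₁ y) (hw₂ : ∀ y, 0 ≤ w₂ y)
    {T : (g.Site → ℝ) →ₗ[ℝ] (X' → ℝ)} {N : g.Site → g.Site → ℝ} (hN : ∀ y u, 0 ≤ N y u) :
    HasMaj (wnorm (BlockNorm.ofBlocks g (fun y : g.Site => y)) w₁ hw₁) (wnorm (BlockNorm.ofBlocks g blk') w₂ hw₂) T N ↔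
      ∀ (x' : X') (u : g.Site), w₂ (blk' x') * |entry T x' u| ≤ N (blk' x') u * w₁ u := by
  constructor
  · intro h x' u
    exact entry_le_of_hasMaj_wnorm (fun y : g.Site => y) blk' hw₁ hw₂ h x' u
  · intro h u μ hμ y
    have hμe : μ = μ u • Pi.single u (1 : ℝ) := T4EtaRateDefectSite.eq_single_of_isLoc_id hμ
    show w₂ y * (BlockNorm.ofBlocks g blk').loc y (T μ) ≤
      N y u * (w₁ u * (BlockNorm.ofBlocks g (fun y : g.Site => y)).loc u μ)
    rw [T4EtaRateDefectSite.loc_ofBlocks_id, hμe, map_smul]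
    have e2 : |(μ u • Pi.single u (1 : ℝ) : g.Site → ℝ) u| = |μ u| := by simp
    rw [e2]
    have hμ0 : 0 ≤ |μ u| := abs_nonneg _
    set c : ℝ := |μ u| * (N y u * w₁ u) with hc
    have hc0 : 0 ≤ c := mul_nonneg hμ0 (mul_nonneg (hN y u) (hw₁ u))
    -- the pointwise hypothesis on the cube `y`
    have hpt : ∀ x' : X', blk' x' = y → w₂ y * |(μ u • T (Pi.single u (1 : ℝ))) x'| ≤ c := by
      intro x' hx'
      have hx := h x' u
      rw [hx', entry_apply] at hx
      rw [Pi.smul_apply, smul_eq_mul, abs_mul]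
      calc w₂ y * (|μ u| * |T (Pi.single u 1) x'|) = |μ u| * (w₂ y * |T (Pi.single u 1) x'|) := by ring
        _ ≤ |μ u| * (N y u * w₁ u) := mul_le_mul_of_nonneg_left hx hμ0
    by_cases hw : w₂ y = 0
    · rw [hw, zero_mul]
      exact mul_nonneg (hN y u) (mul_nonneg (hw₁ u) hμ0)
    · have hwpos : 0 < w₂ y := lt_of_le_of_ne (hw₂ y) (Ne.symm hw)
      have hloc : (BlockNorm.ofBlocks g blk').loc y (μ u • T (Pi.single u (1 : ℝ))) ≤ c / w₂ y :=
        loc_ofBlocks_le blk' _ (div_nonneg hc0 hwpos.le) fun x' hx' => by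
          rw [le_div_iff₀ hwpos, mul_comm]
          exact hpt x' hx'
      calc w₂ y * (BlockNorm.ofBlocks g blk').loc y (μ u • T (Pi.single u (1 : ℝ)))
          ≤ w₂ y * (c / w₂ y) := mul_le_mul_of_nonneg_left hloc hwpos.le
        _ = c := mul_div_cancel₀ c hw
        _ = N y u * (w₁ u * |μ u|) := by rw [hc]; ring

end Dictionary

/-! ## §4 The reading: binder (a) of the background step for kernel operators -/

section Reading

variable {g : B6.Geometry} [DecidableEq g.Site] {X' : Type} [Fintype X'] (π : X' → g.Site)

/-- **BINDER (a) FOR KERNEL OPERATORS IS A POINTWISE KERNEL INEQUALITY.**  With the coarse lattice the sites 𝔅 themselves and the fine lattice `X′`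
blocked by the pairing's `π`, the source-weighted, observation-weighted block majorant of the η-defect of two kernel operators,
`HasMaj (wnorm (ofBlocks id) w) (wnorm (ofBlocks π) W) 𝔇(K′, K) N` (`N ≥ 0`), IS
`∀ x′ u, W(πx′)·|Σ_{u′∈π⁻¹(u)} K′(x′,u′) − K(πx′,u)| ≤ N(πx′,u)·w(u)` — the BLOCK-SUMMED fine kernel against the coarse kernel, uniformly in the
position of `x′` inside its block. [cite: King1986, (4.1)–(4.4) p.670 (the block-summed kernel `a_kG_kQ_k*` in momentum space: mechanism)] -/
theorem binderA_iff_kernel_bound {w W : g.Site → ℝ} (hw : ∀ y, 0 ≤ w y) (hW : ∀ y, 0 ≤ W y) (K' : Matrix X' X' ℝ)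
    (K : Matrix g.Site g.Site ℝ) {N : g.Site → g.Site → ℝ} (hN : ∀ y u, 0 ≤ N y u) :
    HasMaj (wnorm (BlockNorm.ofBlocks g (fun y : g.Site => y)) w hw) (wnorm (BlockNorm.ofBlocks g π) W hW)
        (idef (pull π) (pull π) (Matrix.mulVecLin K') (Matrix.mulVecLin K)) N ↔
      ∀ (x' : X') (u : g.Site), W (π x') * |(∑ u' : X', if π u' = u then K' x' u' else 0) - K (π x') u| ≤ N (π x') u * w u := by
  rw [hasMaj_site_cube_iff π hw hW hN]
  refine forall_congr' fun x' => forall_congr' fun u => ?_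
  rw [entry_idef_kernel]

end Reading

end Summit.QuantumFields.YangMills.BalabanUVNodes.N15.KernelDefect
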